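import Literature.NumberTheory.LFunctions.LehmanCriticalLineNumerics
import HarnessLib

/-!
# `|ζ(½ + it)| ≤ 2.53 t^{1/4}` for `39189 / 100 ≤ t ≤ 404`: certified run, chunk 5 of 5

Topic `Literature/NumberTheory/LFunctions`. Pure proof file (kernel computations; nothing is
asserted beyond the displayed inequality). Each `seg5_j_check` evaluates one segment
certificate of `LehmanCriticalLineNumerics.lean` (`CritLineCert.Seg.check`: Euler–Maclaurin boxes
of `ζ`, `ζ'` on a grid of the critical line, the terms `n^{-s}` marched from grid point to grid
point by ball arithmetic, and the second-order Taylor test between grid points) with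
`decide +kernel` (standard axioms only; `maxHeartbeats 0` lifts the deterministic time-out; one
declaration per segment keeps the kernel's memory use bounded), `chain5` checks that the
segments chain over `[39189 / 100, 404]`, and `norm_riemannZeta_half_le_run5` reads off the bound through
`CritLineCert.chain_sound`. The 5 chunks cover `1 ≤ t ≤ 404` (`404 > 128π`) and are assembled in
`LehmanCriticalLineBoundProofs.lean` (Trudgian's footnote to [Trudgian2011, Lemma 2.5]: "A
computational check shows that Lemma 2.5 in fact holds for all `t > 1`"). The segment
parameters (step `h`, cut-offs `N`, `N2`, region data `M0`, `m1`, `r`) were planned in floating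
point outside Lean; only the kernel's verdicts are used.

## References

* T. S. Trudgian, *Improvements to Turing's method*, Math. Comp. 80 (2011), 2259–2279, Lemma 2.5
  and its footnote. [Trudgian2011]
* H. M. Edwards, *Riemann's Zeta Function* (1974), §6.4. [Edwards1974]
-/

noncomputable section

open Complex

namespace Literature.NumberTheory.LFunctions.CritLineCert

set_option maxHeartbeats 0 in
/-- Segment 1 of chunk 5: `t` from `391.89` to `404.19` (step `3 / 10`, `41` steps,
cut-offs `N = 150`, `N2 = 92`; fields `t0, h, m, N, N2, M0, m1, r` of `CritLineCert.Seg`): the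
kernel's verdict. [cite: Trudgian2011, Lemma 2.5 (footnote)] -/
theorem seg5_1_check : (⟨39189 / 100, 3 / 10, 41, 150, 92, 40421 / 100, 9797 / 25, 44491 / 10000⟩ : Seg).check theLogs 160 = true := by
  decide +kernel

/-- The segments of chunk 5 chain over `[39189 / 100, 404]`. [folklore] -/
theorem chain5 : chainOK
  [⟨39189 / 100, 3 / 10, 41, 150, 92, 40421 / 100, 9797 / 25, 44491 / 10000⟩] (39189 / 100) (404) = true := by
  decide +kernel

/-- **`|ζ(½ + it)| ≤ 2.53 t^{1/4}` for `39189 / 100 ≤ t ≤ 404`** (kernel-certified).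
[cite: Trudgian2011, Lemma 2.5 (footnote)] -/
theorem norm_riemannZeta_half_le_run5 (t : ℝ) (h₁ : (39189 / 100 : ℝ) ≤ t) (h₂ : t ≤ 404) :
    ‖riemannZeta (1 / 2 + t * I)‖ ≤ 2.53 * t ^ (1 / 4 : ℝ) := by
  have h := chain_sound theLogs_valid theLogs_powHalf
    [⟨39189 / 100, 3 / 10, 41, 150, 92, 40421 / 100, 9797 / 25, 44491 / 10000⟩] (39189 / 100) (404)
    (List.forall_mem_cons.2 ⟨seg5_1_check, List.forall_mem_nil _⟩)
    chain5 t
  push_cast at h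
  exact h h₁ h₂

end Literature.NumberTheory.LFunctions.CritLineCert
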